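import Literature.Topology.FourManifolds.Trisections
import Literature.Topology.FourManifolds.ImmersionOrientation
import Literature.Topology.FourManifolds.BoundaryOrientation
import Literature.Topology.FourManifolds.InteriorDiscs
import HarnessLib

/-!
# The handlebodies of a Gay–Kirby trisection are orientable, I: the interior

Topic `Literature/Topology/FourManifolds`; written for the fact seat of (g′)
`exists_marking_centralSurface_of_gkTrisection` (`TrisectionFunctorGK.lean`).  Gay–Kirby's
Def. 1 asks the double intersections `H_{ij} = X_i ∩ X_j` of a trisection to be genus-`g`
handlebodies, in particular **orientable**; the tree's faithful predicate `IsGKTrisection`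
(`Trisections.lean`) records in clause (iii) only that `H_{ij}` is the image of a smooth
embedding `f : H → X` of a compact connected `3`-manifold with one `0`-handle and `g`
`1`-handles, and orientability has to be *derived* from the orientation of `X`.  This file does
the geometric part of that derivation, in the following abstract set-up
(`TwoSidedHypersurface.Setup e f F`, satisfied by the clause-(ii) piece `e : W → X` of the sector
`X_i` and the clause-(iii) embedding `f : H → X` of `H_{ij}`, with `F` the central surface —
`IsGKTrisection.exists_setup`):

* `e : W → X` is a topological embedding of a `4`-manifold with boundary which is a `C^∞`
  immersion at every point not sent into the closed set `F`;
* `f : H → X` is a smooth embedding of a `3`-manifold with boundary with `f(H) ⊆ e(∂W)` and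
  `f(∂H) = F`.

Then (everything proved; no named facts):

* `Setup.orientationOff` — the open part `W off F = {w | e w ∉ F}` of `W` inherits an
  orientation from an orientation of `X` (codimension-`0` immersion, the tree's
  `SmoothOrientation.comapOfDetNeZero`; Hirsch §4.4 p. 101), hence so does its boundary
  (`SmoothOrientation.boundary`, `BoundaryOrientation.lean`; Hirsch §4.4 p. 103);
* `Setup.lift` — the interior of `H` maps into `∂(W off F)` by `g = e⁻¹ ∘ f`, a `C^∞` map
  (`Setup.contMDiff_lift`: smoothness is tested through the immersions `e`, `W off F ↪ W` and
  `∂ ↪ W off F`, Mathlib's `ContMDiffAt.iff_comp_isImmersionAt`) with invertible differential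
  (`Setup.det_mfderiv_lift_ne_zero`: composing with `d(e ∘ ι)` gives the injective `d(f ∘ ι)`);
* `Setup.orientationInterior`, `Setup.isOrientable_interiorManifold` — **the boundaryless
  interior `InteriorManifold (𝓡∂ 3) H` of `H` is orientable**;
* `IsGKTrisection.isOrientable_interiorManifold_of_clause_iii` — the same for the clause-(iii)
  data of any double intersection of a Gay–Kirby trisection of an orientable `X`.

The passage from the interior to `H` itself ("orientability is decided on the interior",
`InteriorOrientationExtension.lean`) and the conclusion `IsHandlebody g H_{ij}` are assembled in
a sequel.

## References

* D. Gay, R. Kirby, *Trisecting 4-manifolds*, Geom. Topol. 20 (2016), Def. 1 and Remark 2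
  (p. 3098). [GayKirby2016]
* M. W. Hirsch, *Differential Topology*, GTM 33 (1976), §4.4, pp. 101–103 (induced and
  boundary orientations). [HirschDT1976]
-/

open scoped Manifold ContDiff Topology
open Set Function Filter

noncomputable section

namespace Literature.Topology.FourManifolds

universe u

/-- Local notation: `𝔼 n` is the model Euclidean space `EuclideanSpace ℝ (Fin n)`. -/
local notation "𝔼 " n:arg => EuclideanSpace ℝ (Fin n)

namespace TwoSidedHypersurface

variable {X : Type u} [TopologicalSpace X] [ChartedSpace (𝔼 4) X]
  {W : Type u} [TopologicalSpace W] [ChartedSpace (EuclideanHalfSpace 4) W]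
  {H : Type u} [TopologicalSpace H] [ChartedSpace (EuclideanHalfSpace 3) H]
  {e : W → X} {f : H → X} {F : Set X}

/-- **The set-up**: a compact `3`-manifold with boundary `H` smoothly embedded by `f` into the
smooth `4`-manifold `X` inside the boundary face `e(∂W)` of a `4`-manifold with boundary `W`
topologically embedded by `e`, which is a `C^∞` immersion off the closed set `F = f(∂H)`.
This is the configuration of a double intersection `H_{ij} ⊆ ∂X_i` of a Gay–Kirby trisection
(`IsGKTrisection`, clauses (ii) and (iii), with `F` the central surface). [cite: GayKirby2016, Def. 1] -/
structure Setup (e : W → X) (f : H → X) (F : Set X) : Prop where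
  /-- `e` is a topological embedding. -/
  isEmbedding : Topology.IsEmbedding e
  /-- `F` is closed. -/
  isClosed : IsClosed F
  /-- `e` is a `C^∞` immersion at every point not sent into `F`. -/
  isImmersionAt : ∀ w, e w ∉ F → Manifold.IsImmersionAt (𝓡∂ 4) (𝓡 4) ∞ e w
  /-- `f` is a smooth embedding. -/
  isSmoothEmbedding : Manifold.IsSmoothEmbedding (𝓡∂ 3) (𝓡 4) ∞ f
  /-- `f(H)` lies in the face `e(∂W)`. -/
  range_subset : range f ⊆ e '' (𝓡∂ 4).boundary W
  /-- `F` is the image of the boundary of `H`. -/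
  image_boundary : f '' (𝓡∂ 3).boundary H = F

namespace Setup

variable (s : Setup e f F)
include s

/-- `range f ⊆ range e`. [folklore] -/
theorem range_subset_range : range f ⊆ range e :=
  s.range_subset.trans (image_subset_range _ _)

/-! #### The part of the sector piece `W` off the closed set `F` -/

/-- The open subset `W off F = {w | e w ∉ F}` of `W`. [folklore] -/
def off : TopologicalSpace.Opens W :=
  ⟨{w | e w ∉ F}, (s.isClosed.preimage s.isEmbedding.continuous).isOpen_compl⟩

/-- Membership in `W off F`. [folklore] -/
theorem mem_off_iff (w : W) : w ∈ s.off ↔ e w ∉ F := Iff.rfl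

/-! #### Lifting the hypersurface into the boundary of `W off F` -/

/-- The point of `W` under `f x`: `e⁻¹ (f x)`. [folklore] -/
def liftW (x : H) : W := s.isEmbedding.toHomeomorph.symm ⟨f x, s.range_subset_range ⟨x, rfl⟩⟩

/-- `e (liftW x) = f x`. [folklore] -/
theorem e_liftW (x : H) : e (s.liftW x) = f x := by
  have h := congrArg Subtype.val
    (s.isEmbedding.toHomeomorph.apply_symm_apply ⟨f x, s.range_subset_range ⟨x, rfl⟩⟩)
  rw [Topology.IsEmbedding.toHomeomorph_apply_coe] at h
  exact h

/-- `liftW` is continuous (`e⁻¹ ∘ f` on the range of `e`). [folklore] -/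
theorem continuous_liftW : Continuous s.liftW :=
  s.isEmbedding.toHomeomorph.symm.continuous.comp
    (s.isSmoothEmbedding.isEmbedding.continuous.subtype_mk _)

/-- The lifted points lie on the boundary of `W`. [folklore] -/
theorem liftW_mem_boundary (x : H) : s.liftW x ∈ (𝓡∂ 4).boundary W := by
  obtain ⟨w, hw, hwx⟩ := s.range_subset ⟨x, rfl⟩
  have : w = s.liftW x := s.isEmbedding.injective (hwx.trans (s.e_liftW x).symm)
  exact this ▸ hw

/-- An interior point of `H` is not sent into `F = f(∂H)` (injectivity of `f`). [folklore] -/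
theorem f_val_notMem (x : InteriorManifold (𝓡∂ 3) H) : f x.val ∉ F := by
  rw [← s.image_boundary]
  rintro ⟨y, hy, hyx⟩
  have : y = x.val := s.isSmoothEmbedding.isEmbedding.injective hyx
  exact x.val_notMem_boundary (this ▸ hy)

/-- The lift of an interior point lies in `W off F`. [folklore] -/
theorem liftW_mem_off (x : InteriorManifold (𝓡∂ 3) H) : s.liftW x.val ∈ s.off := by
  rw [mem_off_iff, s.e_liftW]
  exact s.f_val_notMem x

variable [IsManifold (𝓡 4) ∞ X] [IsManifold (𝓡∂ 4) ∞ W] [IsManifold (𝓡∂ 3) ∞ H]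

omit [IsManifold (𝓡 4) ∞ X] [IsManifold (𝓡∂ 3) ∞ H] in
/-- **The differential of `e` restricted to `W off F` is invertible** (there `e` is a `C^∞`
immersion between `4`-manifolds, and so is the inclusion of the open subset). [folklore] -/
theorem det_mfderiv_ne_zero (w : s.off) :
    LinearMap.det (M := 𝔼 4)
      (mfderiv (𝓡∂ 4) (𝓡 4) (e ∘ (Subtype.val : s.off → W)) w).toLinearMap ≠ 0 := by
  have h1 : Manifold.IsImmersionAt (𝓡∂ 4) (𝓡 4) ∞ e w.1 := s.isImmersionAt w.1 w.2
  have h2 : Manifold.IsImmersionAt (𝓡∂ 4) (𝓡∂ 4) ∞ (Subtype.val : s.off → W) w :=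
    Manifold.IsImmersionAt.of_opens s.off w.2
  have hd1 : MDifferentiableAt (𝓡∂ 4) (𝓡 4) e w.1 := h1.contMDiffAt.mdifferentiableAt (by simp)
  have hd2 : MDifferentiableAt (𝓡∂ 4) (𝓡∂ 4) (Subtype.val : s.off → W) w :=
    h2.contMDiffAt.mdifferentiableAt (by simp)
  have hinj : Injective (mfderiv (𝓡∂ 4) (𝓡 4) (e ∘ (Subtype.val : s.off → W)) w) := by
    rw [mfderiv_comp w hd1 hd2]
    intro v₁ v₂ hv
    exact injective_mfderiv_of_isImmersionAt' h2 (injective_mfderiv_of_isImmersionAt' h1 hv)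
  set A : (𝔼 4) →ₗ[ℝ] 𝔼 4 :=
    (mfderiv (𝓡∂ 4) (𝓡 4) (e ∘ (Subtype.val : s.off → W)) w).toLinearMap with hA
  have hinjA : Injective A := hinj
  have hunit : IsUnit A := (LinearMap.isUnit_iff_ker_eq_bot A).2 (LinearMap.ker_eq_bot.2 hinjA)
  exact ((LinearMap.isUnit_iff_isUnit_det A).1 hunit).ne_zero

omit [IsManifold (𝓡 4) ∞ X] [IsManifold (𝓡∂ 4) ∞ W] [IsManifold (𝓡∂ 3) ∞ H] in
/-- `e` restricted to `W off F` is `C^∞`. [folklore] -/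
theorem contMDiff_comp_val : ContMDiff (𝓡∂ 4) (𝓡 4) ∞ (e ∘ (Subtype.val : s.off → W)) :=
  fun w => contMDiffAt_subtype_iff.2 (s.isImmersionAt w.1 w.2).contMDiffAt

/-- **`W off F` inherits an orientation from an orientation of `X`** (pullback along the
codimension-`0` immersion `e`; `SmoothOrientation.comapOfDetNeZero`, Hirsch §4.4 p. 101).
[cite: HirschDT1976, §4.4 p. 101] -/
def orientationOff (o : SmoothOrientation (𝓡 4) X) : SmoothOrientation (𝓡∂ 4) s.off :=
  o.comapOfDetNeZero (e ∘ Subtype.val) s.contMDiff_comp_val (by simp) s.det_mfderiv_ne_zero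


/-- **The lift `g : Int H → ∂(W off F)`** of the interior of the hypersurface into the boundary
of `W off F`: `x ↦ e⁻¹ (f x)`. [folklore] -/
def lift (x : InteriorManifold (𝓡∂ 3) H) : (𝓡∂ 4).boundary s.off :=
  ⟨⟨s.liftW x.val, s.liftW_mem_off x⟩, by
    rw [ModelWithCorners.boundary_open]
    exact s.liftW_mem_boundary x.val⟩

omit [IsManifold (𝓡 4) ∞ X] [IsManifold (𝓡∂ 4) ∞ W] [IsManifold (𝓡∂ 3) ∞ H] in
/-- `e (lift x) = f x`. [folklore] -/
theorem e_lift (x : InteriorManifold (𝓡∂ 3) H) : e (s.lift x).1.1 = f x.val :=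
  s.e_liftW x.val

omit [IsManifold (𝓡 4) ∞ X] [IsManifold (𝓡∂ 4) ∞ W] [IsManifold (𝓡∂ 3) ∞ H] in
/-- `g` is continuous. [folklore] -/
theorem continuous_lift : Continuous s.lift :=
  Continuous.subtype_mk (Continuous.subtype_mk
    (s.continuous_liftW.comp InteriorManifold.continuous_val) _) _

omit [IsManifold (𝓡 4) ∞ X] [IsManifold (𝓡∂ 4) ∞ W] in
/-- `x ↦ liftW x` is `C^∞` on the interior manifold (smoothness is tested after composing with
the immersion `e`, which gives `f ∘ val`; Mathlib `ContMDiffAt.iff_comp_isImmersionAt`).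
[folklore] -/
theorem contMDiffAt_liftW_val (x : InteriorManifold (𝓡∂ 3) H) :
    ContMDiffAt 𝓘(ℝ, 𝔼 3) (𝓡∂ 4) ∞
      (fun y : InteriorManifold (𝓡∂ 3) H => s.liftW y.val) x := by
  have hx : e (s.liftW x.val) ∉ F := s.liftW_mem_off x
  rw [ContMDiffAt.iff_comp_isImmersionAt (f := fun y : InteriorManifold (𝓡∂ 3) H => s.liftW y.val)
    (x := x) (s.isImmersionAt _ hx)]
  refine ⟨?_, ?_⟩
  · exact (s.continuous_liftW.comp InteriorManifold.continuous_val).continuousAt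
  · have hcomp : (e ∘ fun y : InteriorManifold (𝓡∂ 3) H => s.liftW y.val) =
        f ∘ InteriorManifold.val := by
      funext y; exact s.e_liftW y.val
    rw [hcomp]
    exact (InteriorManifold.contMDiff_comp_val s.isSmoothEmbedding.contMDiff) x

omit [IsManifold (𝓡 4) ∞ X] [IsManifold (𝓡∂ 4) ∞ W] in
/-- `g` followed by the inclusion of the boundary is `C^∞` (a map into the open subset
`W off F`). [folklore] -/
theorem contMDiffAt_val_lift (x : InteriorManifold (𝓡∂ 3) H) :
    ContMDiffAt 𝓘(ℝ, 𝔼 3) (𝓡∂ 4) ∞ (Subtype.val ∘ s.lift) x := by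
  have h' : ContMDiffAt 𝓘(ℝ, 𝔼 3) (𝓡∂ 4) ∞
      (Subtype.val ∘ (Subtype.val ∘ s.lift)) x := s.contMDiffAt_liftW_val x
  exact (ContMDiffAt.subtypeVal_comp_iff s.off (Subtype.val ∘ s.lift) x).1 h'

omit [IsManifold (𝓡 4) ∞ X] in
/-- **`g : Int H → ∂(W off F)` is `C^∞`** for the boundary-manifold structure
(`BoundaryManifold`); smoothness is tested after composing with the smooth embedding
`∂ ↪ W off F`. [folklore] -/
theorem contMDiffAt_lift (x : InteriorManifold (𝓡∂ 3) H) :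
    ContMDiffAt 𝓘(ℝ, 𝔼 3) (𝓡 3) ∞ s.lift x := by
  have hval : Manifold.IsImmersionAt (𝓡 3) (𝓡∂ 4) ∞
      (Subtype.val : (𝓡∂ 4).boundary s.off → s.off) (s.lift x) :=
    (BoundaryManifold.isSmoothEmbedding_subtype_val (n := 3) (W := s.off)).isImmersion.isImmersionAt _
  rw [ContMDiffAt.iff_comp_isImmersionAt (f := s.lift) (x := x) hval]
  exact ⟨s.continuous_lift.continuousAt, s.contMDiffAt_val_lift x⟩

omit [IsManifold (𝓡 4) ∞ X] in
/-- `g` is `C^∞`. [folklore] -/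
theorem contMDiff_lift : ContMDiff 𝓘(ℝ, 𝔼 3) (𝓡 3) ∞ s.lift := fun x => s.contMDiffAt_lift x

/-! #### The differential of the lift is invertible; the induced orientation of `Int H` -/

omit [IsManifold (𝓡 4) ∞ X] [IsManifold (𝓡∂ 4) ∞ W] [TopologicalSpace X] [ChartedSpace (𝔼 4) X]
  [TopologicalSpace W] [ChartedSpace (EuclideanHalfSpace 4) W] s in
/-- The differential of the inclusion `Int H → H` is the identity (the extended charts of the
interior are those of `H`). [folklore] -/
theorem mfderiv_val_eq_id (x : InteriorManifold (𝓡∂ 3) H) :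
    mfderiv 𝓘(ℝ, 𝔼 3) (𝓡∂ 3) (InteriorManifold.val : InteriorManifold (𝓡∂ 3) H → H) x =
      ContinuousLinearMap.id ℝ (𝔼 3) := by
  have h := InteriorManifold.mfderiv_eq_mfderiv_comp_val (J := 𝓘(ℝ, 𝔼 3))
    (id : InteriorManifold (𝓡∂ 3) H → InteriorManifold (𝓡∂ 3) H) x
  rw [mfderiv_id] at h
  exact h.symm

omit [IsManifold (𝓡 4) ∞ X] [IsManifold (𝓡∂ 4) ∞ W] in
/-- The differential of `f ∘ val : Int H → X` is injective (`f` is an immersion). [folklore] -/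
theorem injective_mfderiv_f_comp_val (x : InteriorManifold (𝓡∂ 3) H) :
    Injective (mfderiv 𝓘(ℝ, 𝔼 3) (𝓡 4) (f ∘ InteriorManifold.val) x) := by
  have hf : Manifold.IsImmersionAt (𝓡∂ 3) (𝓡 4) ∞ f x.val :=
    s.isSmoothEmbedding.isImmersion.isImmersionAt x.val
  have hd1 : MDifferentiableAt (𝓡∂ 3) (𝓡 4) f x.val := hf.contMDiffAt.mdifferentiableAt (by simp)
  have hd2 : MDifferentiableAt 𝓘(ℝ, 𝔼 3) (𝓡∂ 3)
      (InteriorManifold.val : InteriorManifold (𝓡∂ 3) H → H) x :=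
    (InteriorManifold.contMDiff_val x).mdifferentiableAt (by simp)
  rw [mfderiv_comp x hd1 hd2, mfderiv_val_eq_id]
  intro v₁ v₂ hv
  exact injective_mfderiv_of_isImmersionAt' hf hv

omit [IsManifold (𝓡 4) ∞ X] [IsManifold (𝓡∂ 3) ∞ H] in
/-- `e ∘ val ∘ val : ∂(W off F) → X` is `C^∞`. [folklore] -/
theorem contMDiff_e_val_val :
    ContMDiff (𝓡 3) (𝓡 4) ∞
      (e ∘ Subtype.val ∘ Subtype.val : (𝓡∂ 4).boundary s.off → X) :=
  s.contMDiff_comp_val.comp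
    (BoundaryManifold.isSmoothEmbedding_subtype_val (n := 3) (W := s.off)).contMDiff

omit [IsManifold (𝓡 4) ∞ X] in
/-- **The differential of the lift `g : Int H → ∂(W off F)` is invertible**: composing with
the differential of `e ∘ ι : ∂(W off F) → X` gives the injective differential of `f ∘ ι`.
[folklore] -/
theorem det_mfderiv_lift_ne_zero (x : InteriorManifold (𝓡∂ 3) H) :
    LinearMap.det (M := 𝔼 3) (mfderiv 𝓘(ℝ, 𝔼 3) (𝓡 3) s.lift x).toLinearMap ≠ 0 := by
  have hcomp : (e ∘ Subtype.val ∘ Subtype.val : (𝓡∂ 4).boundary s.off → X) ∘ s.lift =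
      f ∘ InteriorManifold.val := funext fun y => s.e_lift y
  have hE : MDifferentiableAt (𝓡 3) (𝓡 4)
      (e ∘ Subtype.val ∘ Subtype.val : (𝓡∂ 4).boundary s.off → X) (s.lift x) :=
    (s.contMDiff_e_val_val (s.lift x)).mdifferentiableAt (by simp)
  have hL : MDifferentiableAt 𝓘(ℝ, 𝔼 3) (𝓡 3) s.lift x :=
    (s.contMDiffAt_lift x).mdifferentiableAt (by simp)
  have hchain := mfderiv_comp x hE hL
  rw [hcomp] at hchain
  have hinj : Injective (mfderiv 𝓘(ℝ, 𝔼 3) (𝓡 3) s.lift x) := by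
    intro v₁ v₂ hv
    apply s.injective_mfderiv_f_comp_val x
    rw [hchain]
    show (mfderiv (𝓡 3) (𝓡 4) (e ∘ Subtype.val ∘ Subtype.val : (𝓡∂ 4).boundary s.off → X)
      (s.lift x)) (mfderiv 𝓘(ℝ, 𝔼 3) (𝓡 3) s.lift x v₁) = _
    rw [hv]
    rfl
  set A : (𝔼 3) →ₗ[ℝ] 𝔼 3 := (mfderiv 𝓘(ℝ, 𝔼 3) (𝓡 3) s.lift x).toLinearMap with hA
  have hinjA : Injective A := hinj
  have hunit : IsUnit A := (LinearMap.isUnit_iff_ker_eq_bot A).2 (LinearMap.ker_eq_bot.2 hinjA)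
  exact ((LinearMap.isUnit_iff_isUnit_det A).1 hunit).ne_zero

/-- **The interior of the hypersurface inherits an orientation from an orientation of `X`**:
`X` orients `W off F` (codimension-`0` immersion `e`), whose boundary is oriented by the
outward normal (`SmoothOrientation.boundary`, Hirsch §4.4 p. 103), and the interior of `H`
maps into that boundary by the local diffeomorphism `g` (pullback `comapOfDetNeZero`).
[cite: HirschDT1976, §4.4 pp. 101–103] -/
def orientationInterior (o : SmoothOrientation (𝓡 4) X) :
    SmoothOrientation 𝓘(ℝ, 𝔼 3) (InteriorManifold (𝓡∂ 3) H) :=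
  (s.orientationOff o).boundary.comapOfDetNeZero s.lift s.contMDiff_lift (by simp)
    s.det_mfderiv_lift_ne_zero

/-- **The interior of a two-sided hypersurface of an orientable `4`-manifold, in the set-up of a
trisection, is orientable.** [cite: HirschDT1976, §4.4 pp. 101–103] -/
theorem isOrientable_interiorManifold (ho : IsOrientable (𝓡 4) X) :
    IsOrientable 𝓘(ℝ, 𝔼 3) (InteriorManifold (𝓡∂ 3) H) := by
  obtain ⟨o⟩ := ho
  exact ⟨s.orientationInterior o⟩

end Setup

end TwoSidedHypersurface

/-! ### Gay–Kirby trisections: the interior of each handlebody `H_{ij}` is orientable -/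

section Trisection

variable {X : Type u} [TopologicalSpace X] [T2Space X] [ChartedSpace (𝔼 4) X]
  [IsManifold (𝓡 4) ∞ X] {g : ℕ} {k : Fin 3 → ℕ} {S : Fin 3 → Set X}

omit [IsManifold (𝓡 4) ∞ X] in
/-- The central surface of a Gay–Kirby trisection of a Hausdorff manifold is closed (an
intersection of compact sectors). [cite: GayKirby2016, Def. 1] -/
theorem IsGKTrisection.isClosed_iInter (h : IsGKTrisection X g k S) : IsClosed (⋂ l, S l) :=
  _root_.isClosed_iInter fun l => (h.isCompact l).isClosed

omit [IsManifold (𝓡 4) ∞ X] in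
/-- **The set-up of `TwoSidedHypersurface` holds for every double intersection of a Gay–Kirby
trisection**: given the clause-(iii) data `f : H → X` of `S i ∩ S j` (`i ≠ j`), the
clause-(ii) piece `e : W → X` of the sector `S i` embeds `W`, is an immersion off the central
surface `F`, and `f(H) = S i ∩ S j ⊆ e(∂W)`, `f(∂H) = F`. [cite: GayKirby2016, Def. 1] -/
theorem IsGKTrisection.exists_setup (h : IsGKTrisection X g k S) {i j : Fin 3} (hij : i ≠ j)
    {H : Type u} [TopologicalSpace H] [ChartedSpace (EuclideanHalfSpace 3) H] (f : H → X)
    (hf : Manifold.IsSmoothEmbedding (𝓡∂ 3) (𝓡 4) ∞ f) (hrange : range f = S i ∩ S j)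
    (hbd : f '' (𝓡∂ 3).boundary H = ⋂ l, S l) :
    ∃ (W : Type u) (_ : TopologicalSpace W) (_ : ChartedSpace (EuclideanHalfSpace 4) W)
      (e : W → X), IsManifold (𝓡∂ 4) ∞ W ∧ TwoSidedHypersurface.Setup e f (⋂ l, S l) := by
  obtain ⟨W, _, _, e, hM, -, -, -, he, -, himm, -, hface⟩ := h.2.1 i
  refine ⟨W, _, _, e, hM, ⟨he, h.isClosed_iInter, himm, hf, ?_, hbd⟩⟩
  rw [hrange]
  exact hface j hij.symm

/-- **The interior of each handlebody `H_{ij}` of a Gay–Kirby trisection of an orientable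
4-manifold is orientable** (`TwoSidedHypersurface.Setup.isOrientable_interiorManifold`: `H_{ij}`
minus the central surface lies, as an open subset, in the boundary face `e(∂W)` of the sector
piece `W` of `S i`, which is oriented off `F` as a codimension-`0` immersed piece of `X`).  Gay
and Kirby take the `H_{ij}` to be (orientable) genus-`g` handlebodies (Def. 1, Remark 2); this is
the part of that assertion which the tree's predicate `IsGKTrisection` leaves to be proved.
[cite: GayKirby2016, Def. 1 and Remark 2 (p. 3098)] [cite: HirschDT1976, §4.4 pp. 101–103] -/
theorem IsGKTrisection.isOrientable_interiorManifold_of_clause_iii (h : IsGKTrisection X g k S)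
    (ho : IsOrientable (𝓡 4) X) {i j : Fin 3} (hij : i ≠ j)
    {H : Type u} [TopologicalSpace H] [ChartedSpace (EuclideanHalfSpace 3) H]
    [IsManifold (𝓡∂ 3) ∞ H] (f : H → X)
    (hf : Manifold.IsSmoothEmbedding (𝓡∂ 3) (𝓡 4) ∞ f) (hrange : range f = S i ∩ S j)
    (hbd : f '' (𝓡∂ 3).boundary H = ⋂ l, S l) :
    IsOrientable 𝓘(ℝ, 𝔼 3) (InteriorManifold (𝓡∂ 3) H) := by
  obtain ⟨W, _, _, e, hM, s⟩ := h.exists_setup hij f hf hrange hbd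
  haveI := hM
  exact s.isOrientable_interiorManifold ho

end Trisection

end Literature.Topology.FourManifolds
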